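import Summits.RiemannHypothesis.RiemannHypothesis.Theorems.GroundBartaPolarPerronFrobeniusParitySign
import HarnessLib

/-!
# RiemannHypothesis / GroundBarta — crux `PolarPerronFrobenius` (stmt-RiemannHypothesis-18390):
# NEGATIVE knowledge — the shape of a disproof, the degenerate window, and the rank-one PF toy

Negative-side helper file of the standing disprover (`--supports stmt-RiemannHypothesis-18390`; lane
`Theorems/PolarPerronFrobenius/Negative/`), RH-free, Mathlib + landed tree files only, no definitions, no named
facts, no sorry.  Companion of the disprover's work file `Cruxes/PolarPerronFrobenius/Disproof.lean` (findings
F1–F3 there; F4–F6 — edge law, numerics, line `Sketch` — are analysis/prose and stay in the work file).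

1. `not_polarPerronFrobenius_of_tail_of_holes` — the only disproof shape (converse half of B's negation
   normal form `not_polarPerronFrobenius_iff`): eventual even-winning (the TAIL of rung 4) plus eventual HOLES
   (no large window carries a one-signed ground state) refute the crux;
   `not_polarPerronFrobenius_of_not_riemannHypothesis_of_tail` — off the critical line the holes are free
   (B's `eventually_not_oneSigned_of_not_riemannHypothesis`), so a disproof under `¬RH` is exactly the tail.
2. `polarMatrix_false_of_nonpos` — the crux's matrix `EW a → GSP a` (route-inline vocabulary) is FALSE at
   every `a ≤ 0` (contrapositive of B's `pos_of_polarMatrix`): the cofinal quantifier cannot be discharged at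
   degenerate windows.
3. `toy_rankOne_not_oneSigned` — **the named mechanism carries no sign**: a `2 × 2` generator `M` of a
   positivity-preserving semigroup plus `2ccᵀ` with `c > 0` entrywise whose bottom eigenvector is
   antisymmetric (`M = [[0,-1],[-1,0]]`, `c = (2,2)`, `M + 2ccᵀ = [[8,7],[7,8]]`: bottom `1` at `(1,-1)/√2`, every
   non-negative unit vector has Rayleigh quotient `≥ 8`).  The windowed Weil form `P + 𝓔_a − M_a‖·‖²` has
   exactly this structure (`P = 2|⟨·, cosh(t/2)⟩|²`); cf. B's `sw_not_signImproving_of_ge`.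

Refuter `refuter-cdisprove-stmt-RiemannHypothesis-18390-0` (cdisprove cycle 1).  References: E. Bombieri,
Rend. Lincei (9) 11 (2000) §4; prover B's `…ParitySign`, `…EvenRealGroundState`.
-/

set_option linter.dupNamespace false

noncomputable section

open MeasureTheory Complex Filter Set
open scoped Real Topology

namespace Summit.RiemannHypothesis.RiemannHypothesis.Theorems.PolarPerronFrobenius.Negative

open Literature.NumberTheory.LFunctions
open Summit.RiemannHypothesis.RiemannHypothesis.Theses.GroundBarta
open Summit.RiemannHypothesis.RiemannHypothesis.Theorems.PolarPerronFrobenius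

/-! ### 1. The shape of a disproof -/

/-- Negation normal form of the crux (prover B, `…EvenRealGroundState`): `¬C ↔ ∃ A, ∀ a ≥ A, ε_ev(a) ≤ ε_od(a) ∧`
(no ground state at `a` is real and `≥ 0` a.e. on `(-a, a)`) — cited so that this file breaks if it moves. -/
example := @not_polarPerronFrobenius_iff

/-- **The hole programme.**  Eventual even-winning (the TAIL of rung 4) together with eventual HOLES (no
large window carries a one-signed ground state) refutes the crux — and, by
`not_polarPerronFrobenius_iff`, nothing less does. [folklore] -/
theorem not_polarPerronFrobenius_of_tail_of_holes
    (htail : ∀ᶠ a in atTop, weilEvenGroundEnergy a ≤ weilOddGroundEnergy a)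
    (hholes : ∀ᶠ a in atTop, ∀ u : ℝ → ℂ, IsWeilGroundState a u →
      ¬ (∀ᵐ t : ℝ, t ∈ Ioo (-a) a → (u t).im = 0 ∧ 0 ≤ (u t).re)) :
    ¬ PolarPerronFrobenius := by
  obtain ⟨A, hA⟩ := eventually_atTop.1 (htail.and hholes)
  exact not_polarPerronFrobenius_iff.2 ⟨A, fun a ha ↦ hA a ha⟩

/-- Under `¬RH` the holes are free (floor + odd detector, B), so a disproof off the line is EXACTLY the tail
of rung 4. [folklore] -/
theorem not_polarPerronFrobenius_of_not_riemannHypothesis_of_tail (hRH : ¬ RiemannHypothesis)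
    (htail : ∀ᶠ a in atTop, weilEvenGroundEnergy a ≤ weilOddGroundEnergy a) :
    ¬ PolarPerronFrobenius :=
  not_polarPerronFrobenius_of_tail_of_holes htail (eventually_not_oneSigned_of_not_riemannHypothesis hRH)

/-! ### 2. The height is load-bearing at the bottom end -/

/-- (a) The height is load-bearing at the bottom end: at a window `a ≤ 0` the crux's matrix `EW a → GSP a`
(route-inline vocabulary) is FALSE — `EW` holds vacuously and no minimising sequence exists
(contrapositive of B's `pos_of_polarMatrix`). [folklore] -/
theorem polarMatrix_false_of_nonpos {a : ℝ} (ha : a ≤ 0) :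
    ¬ ((∀ o : ℝ → ℂ, IsWeilTest o → tsupport o ⊆ Icc (-a) a → (∀ t, o (-t) = -o t) →
        ∫ t, ‖o t‖ ^ 2 = (1 : ℝ) → ∀ δ : ℝ, 0 < δ → ∃ w : ℝ → ℂ, IsWeilTest w ∧
          tsupport w ⊆ Icc (-a) a ∧ (∀ t, w (-t) = w t) ∧ ∫ t, ‖w t‖ ^ 2 = (1 : ℝ) ∧
          (weilQuadratic w).re ≤ (weilQuadratic o).re + δ) →
      ∃ u : ℝ → ℂ, (MemLp u 2 ∧ ∃ g : ℕ → ℝ → ℂ,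
        (∀ n, IsWeilTest (g n) ∧ tsupport (g n) ⊆ Icc (-a) a ∧ ∫ t, ‖g n t‖ ^ 2 = (1 : ℝ)) ∧
        (∀ h : ℝ → ℂ, IsWeilTest h → tsupport h ⊆ Icc (-a) a → ∫ t, ‖h t‖ ^ 2 = (1 : ℝ) →
          ∀ δ : ℝ, 0 < δ → ∀ᶠ n in atTop, (weilQuadratic (g n)).re ≤ (weilQuadratic h).re + δ) ∧
        Tendsto (fun n ↦ ∫ t, ‖g n t - u t‖ ^ 2) atTop (𝓝 0)) ∧
        (∀ᵐ t : ℝ, t ∈ Ioo (-a) a → (u t).im = 0 ∧ 0 ≤ (u t).re)) :=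
  fun h ↦ absurd (pos_of_polarMatrix h) (not_lt.2 ha)

/-! ### 3. The named mechanism carries no sign: a two-dimensional counterexample -/

/-- **"Perron–Frobenius + positive rank-one along a positive vector ⇒ one-signed ground state" is false.**
With `M = [[0,−1],[−1,0]]` (non-positive off-diagonal: `e^{−tM}` is entrywise `≥ 0`, PF bottom `(1,1)/√2`)
and `c = (2,2)`, the form of `M + 2ccᵀ = [[8,7],[7,8]]` is `q(x,y) = 8x² + 14xy + 8y²`; on the unit circle
`q ≥ 1` with equality at the ANTISYMMETRIC vector `(1,−1)/√2`, while every entrywise non-negative unit vector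
has `q ≥ 8`: the perturbed bottom is not one-signed.  This is the finite-dimensional shadow of
`Re Q = P + 𝓔_a − M_a‖·‖²` with `P = 2|⟨·, cosh(t/2)⟩|²`; cf. `sw_not_signImproving_of_ge`. [folklore] -/
theorem toy_rankOne_not_oneSigned :
    (∀ x y : ℝ, x ^ 2 + y ^ 2 = 1 → (1 : ℝ) ≤ 8 * x ^ 2 + 14 * x * y + 8 * y ^ 2) ∧
    (8 * (Real.sqrt 2 / 2) ^ 2 + 14 * (Real.sqrt 2 / 2) * (-(Real.sqrt 2 / 2)) +
        8 * (-(Real.sqrt 2 / 2)) ^ 2 = 1 ∧ (Real.sqrt 2 / 2) ^ 2 + (-(Real.sqrt 2 / 2)) ^ 2 = 1) ∧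
    (∀ x y : ℝ, 0 ≤ x → 0 ≤ y → x ^ 2 + y ^ 2 = 1 → (8 : ℝ) ≤ 8 * x ^ 2 + 14 * x * y + 8 * y ^ 2) := by
  have h2 : Real.sqrt 2 ^ 2 = 2 := Real.sq_sqrt (by norm_num)
  refine ⟨fun x y h ↦ ?_, ⟨?_, ?_⟩, fun x y hx hy h ↦ ?_⟩
  · nlinarith [sq_nonneg (x + y)]
  · linear_combination (1 / 2 : ℝ) * h2
  · linear_combination (1 / 2 : ℝ) * h2
  · nlinarith [mul_nonneg hx hy]

end Summit.RiemannHypothesis.RiemannHypothesis.Theorems.PolarPerronFrobenius.Negative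

end
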